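import Summits.BirchSwinnertonDyer.BirchSwinnertonDyer.Theorems.RamifiedHeegnerPairLeafShimuraInertSavingCertificate
import Summits.BirchSwinnertonDyer.BirchSwinnertonDyer.Theorems.RamifiedHeegnerPairTwistUnitInert
import Summits.BirchSwinnertonDyer.Rank1Residual.GaloisImage.FrobeniusOrderWitness
import Literature.NumberTheory.EllipticCurves.NoEverywhereGoodReductionRat
import Literature.NumberTheory.EllipticCurves.ZywinaCMImageProofs
import HarnessLib

/-!
# U₁ / U₀ at the SAVING ROWS of the Gss2 census — kernel instances of the inert-set (Shimura-curve) road with one exempted carrier, TU|saving: the DOORS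

Seat `bsd-trib-w-rhp` g15 (TRIBUNAL-W / kit planner) for route `RamifiedHeegnerPair`; helper file `--supports` the crux U₁ `LeafRankOneUpperAtThree`
(stmt-BirchSwinnertonDyer-26022) — its rank-zero door serves the U₀ parts (`LeafRankZeroUpperAtThree`, stmt-BirchSwinnertonDyer-26024).  **HONEST FRAMING: theorems only; per-curve certificates under DISPLAYED inputs (conductor, analytic rank, `3 ∤ c(Dt)`, the twist `L`-value(s), `#Ш(Wd)_an`) and the six
printed facts of the road as hypotheses; nothing is booked, no item is closed; U₁ (26022) / U₀ (26024) / TU|saving / the Shimura-curve Heegner-system inputs stay research-level and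
OPEN class-wide; BSD is NOT proved for any curve by this file.**

## What
rhp-p2 g11's SAVING-ROW certificate shapes (p674548) `LeafShimuraInert.leafRankOneUpper_three_of_shimuraInertDatum_at_saving_of_twistUnit` (`r_an = 1`) and
`…leafRankZeroUpper_three_of_shimuraInertDatum_at_saving_of_twistUnitZero` (`r_an = 0`) prove `MissingUpperBoundAt W 3` at a leaf `W` (`Addv ∧ SubGss` at `3`, `ρ̄₃` onto,
`3 ∤ c(Dt)`) with ONE exempted bad prime `q₁` (the saved carrier: additive with `c_{q₁} = 3`, or split multiplicative) and an even set `S` of multiplicative primes put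
INERT in a Jetchev–Skinner–Wan field `K` (every other `ℓ ∣ N` split), from six printed facts (`hGZK hmod hnf hJL hCO hPrim`: GZK, modularity, newforms, Jacquet–Langlands,
Pasten–Shimura 2024 §6 component orders, the Shimura-curve Heegner system with Gross's primitives at `3`), the très-ramifié clause off `S ∪ {q₁}`, SHAPE off `q₁`
(`3 ∣ c_q ⇒ q` split), (DEG), and ONE twist-unit certificate (`r_an = 1`: `L(W^{(d_K)},1) ≠ 0`; `r_an = 0`: a simple zero; `ord₃ #Ш(W^{(d_K)})_an ≤ 0`).  The saving rows of
rhp-p2 g11 (`N < 5·10⁵`, `ρ̄₃` onto, `S = {s₁, s₂}`): 82 rank-one and 30 rank-zero classes, instantiated in the continuation parts `…TwistUnitSaving B, C, …` /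
`…TwistUnitSavingZero B, C, …`; this part one carries §0 only:
* §0 two DOORS `leafRankOneUpper_three_at_saving_of_sqrtField` / `leafRankZeroUpper_three_at_saving_of_sqrtField`: the instrument's field data at `K = ℚ(√D)` from
  congruences on `D` (inert: `(D/s) = −1`, or `s = 2` and `D ≡ 5 (mod 8)`; split: `(D/ℓ) = +1`, `D ≡ 1 (mod 8)` at `2`), `¬CM` from `ρ̄₃` onto, (DEG) in the flat form
  "`3 ∤ ord_{s₁} Δ_min` or `s₁ = 2 ∨ s₁ ≢ 1 (mod 3)`", and the `hTU` clause for EVERY minimal model of the twist from ONE (`shaAn` model-independence); the generic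
  kernel lemmas (`mem_of_prime_dvd_of_prodPow_eq`, `dvd_minimalDiscriminantInt_of_mult`, `not_three_dvd_localTamagawaNumber_of_not_dvd`) are g14's, used by name;
* per curve (continuation parts): `subGss_three_<label>` (Addv ∧ SubGss at `3` IN THE KERNEL via `V = E^{(-3)}_min`, `#Ṽ(𝔽₃)`), `Δ_eq_/c₄_eq_/krausList_<label>`,
  `surj_three_<label>` (`ρ̄₃` onto IN THE KERNEL by the Frobenius-order witness at two small good primes), Kraus minimality of `V` and of the twist model `Wd`, and
  `u1s_at_<label>` / `u0s_at_<label> : … → MissingUpperBoundAt W 3` whose proof discharges IN THE KERNEL: `q₁ ∣ Δ_min`, the two multiplicative certificates, `hFC`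
  (every prime of `Δ_min` enumerated: additive ⇒ not multiplicative; multiplicative with `3 ∤ ord`; non-split by a no-root certificate), `hshape` off `q₁` (`c_q = 1` off
  `Δ_min`; Kodaira–Néron at multiplicative primes; Tate certificates `TamZ`/`TamLocal`/`TamX` at the other additive primes), (DEG), the Jacobi/congruence conditions of
  the field, and the twist identity `Cd • E^{(D)} = Wd`.
Other roads reach `BSDp` at some of these curves under OTHER displayed inputs (X4 3-descent records, Kolyvagin-index records, TU|add); nothing of theirs is restated.

## Data (kit j322550 / j322551, Sage 10.x + PARI; censuses `Cruxes/RamifiedPairUpperBound/TU-SAVING-CENSUS.md`, `TU0-SAVING-CENSUS.md`)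
Per class (Cremona optimal curve): `D` = the least negative odd fundamental discriminant with `s₁, s₂` inert and every other `ℓ ∣ N` split such that (`r_an = 1`)
`L(E^{(D)},1) ≠ 0` and `ord₃ #Ш(E^{(D)})_an = 0` with Sage's EXACT `L_ratio` on the minimal twist, resp. (`r_an = 0`, among the `D` tried) root number `−1`,
`L′ ≠ 0`, a saturated non-torsion point and `X = L′T²/(Ω∏c ĥ)` an integer prime to `3` to `10⁻⁶`; models / changes / Kraus lists / local tables / nodal roots /
point counts from the same jobs; Tate certificates by the observatory's kernel engine (b2b `kernel-tam3/engine1`) unchanged.  Every numeral that enters a statement is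
re-checked by the kernel except the DISPLAYED ones (`hN hr Dt hc hLt|hLt0 hLt1 hqd hvd`).
[cite: JetchevSkinnerWan2017, §7.4.1–7.4.2 (pp. 30–31), Thm. 4.4.1 (p. 19)] [cite: PastenShimura2024, Prop. 6.13, Lemma 6.15, Lemma 6.16, Lemma 6.18 (pp. 23–24)]
[cite: Jetchev2008, Thm. 1.1] [cite: SilvermanAEC2009, VII.5 Prop. 5.1] [cite: SilvermanATAEC1994, IV.9.4] [cite: Tate1975, §7] [cite: Kraus1989, Prop. 1] [cite: Serre1972, §2.8]
[cite: Zywina2015, Prop. 1.14] [cite: Marcus2018, Ch. 3 Thm. 25] [cite: Miller2011LMS, Def. 1.1] [cite: Cremona2006, Table 1]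
-/

set_option linter.dupNamespace false
set_option autoImplicit false

noncomputable section

open scoped Classical NumberField

open WeierstrassCurve NumberField IsDedekindDomain IsDedekindDomain.HeightOneSpectrum Rat.HeightOneSpectrum Field Literature Literature.NumberTheory.DiophantineGeometry
  Literature.NumberTheory.EllipticCurves Literature.NumberTheory.EllipticCurves.ModularForms Literature.NumberTheory.EllipticCurves.Rank1Residual
  Literature.NumberTheory.EllipticCurves.Rank1Residual.Typed Literature.NumberTheory.Automorphic Literature.NumberTheory.EllipticCurves.Rank1Residual.X11RankOneCertificates
  Literature.NumberTheory.EllipticCurves.KrizLi2019 Literature.NumberTheory.GaloisRepresentations Literature.NumberTheory.QuadraticFields Literature.NumberTheory.QuadraticFields.Quadratic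
  Summit.BirchSwinnertonDyer.BirchSwinnertonDyer.Rank1Residual Summit.BirchSwinnertonDyer.BirchSwinnertonDyer.Rank1Residual.IntModel
  Summit.BirchSwinnertonDyer.BirchSwinnertonDyer.Rank2Observatory.Tam Summit.BirchSwinnertonDyer.Rank1Residual Summit.BirchSwinnertonDyer.Rank1Residual.Additive
  Summit.BirchSwinnertonDyer.Rank1Residual.X11b Summit.BirchSwinnertonDyer.Rank1Residual.X11b.Three Summit.BirchSwinnertonDyer.Rank1Residual.X9 Summit.BirchSwinnertonDyer.Rank1Residual.GaloisImage
  Summit.BirchSwinnertonDyer.Rank1Residual.Supersingular Summit.BirchSwinnertonDyer.BirchSwinnertonDyer.Theses.RamifiedHeegnerPair Summit.BirchSwinnertonDyer.BirchSwinnertonDyer.Theorems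
  Summit.BirchSwinnertonDyer.BirchSwinnertonDyer.Theorems.SchneiderFree Summit.BirchSwinnertonDyer.BirchSwinnertonDyer.Theorems.RamifiedPairUpperBound
  Summit.BirchSwinnertonDyer.BirchSwinnertonDyer.Theorems.RamifiedHeegnerPairStepLIntrinsic Summit.BirchSwinnertonDyer.BirchSwinnertonDyer.Theorems.AdditiveBranchIMCGordTwoRankOne.HeegnerKolyvagin
  Summit.BirchSwinnertonDyer.BirchSwinnertonDyer.Theorems.RamifiedHeegnerPairTwistUnitIntrinsic Summit.BirchSwinnertonDyer.BirchSwinnertonDyer.Theorems.RamifiedHeegnerPairTwistUnitAdditive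
  Summit.BirchSwinnertonDyer.BirchSwinnertonDyer.Theorems.RamifiedHeegnerPairTwistUnitInert

namespace Summit.BirchSwinnertonDyer.BirchSwinnertonDyer.Theorems.RamifiedHeegnerPairTwistUnitSaving

open RamifiedHeegnerPairTwistUnitInert

/-! ## §0 The two DOORS at `K = ℚ(√D)` (rank one / rank zero); the generic kernel lemmas are `RamifiedHeegnerPairTwistUnitInert.*` (g14) -/

/-- **DOOR (TU|saving, rank one): U₁ at a leaf curve on a SAVING ROW from the saving-row certificate shape at `K = ℚ(√D)`.**  rhp-p2 g11's
`LeafShimuraInert.leafRankOneUpper_three_of_shimuraInertDatum_at_saving_of_twistUnit` (p674548) at `S = {s₁, s₂}` (two multiplicative primes, `s₁ ≠ s₂`, both `≠ q₁`):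
its field data — `K` imaginary quadratic with odd `d_K`, `s₁, s₂` inert and unramified, every other `ℓ ∣ N` split (so `q₁` and `3` split) — produced IN THE
KERNEL from congruences on one odd fundamental `D < 0` (`D ≡ 1 (mod 4)` squarefree, `d_K = D`): `(D/sᵢ) = −1`, or `sᵢ = 2` with `D ≡ 5 (mod 8)`; `(D/ℓ) = +1`
at the other odd `ℓ ∣ N` and `D ≡ 1 (mod 8)` when `2 ∣ N`, `2 ∉ S`; `¬CM` from `ρ̄₃` onto (Zywina, `not_hasSurjectiveModNGaloisRep_of_hasCM`); (DEG) in the flat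
form "`3 ∤ ord_{s₁} Δ_min` (très ramifié, first disjunct) or `s₁ = 2 ∨ s₁ ≢ 1 (mod 3)` (pairing disjunct with `R = {s₁}`)"; and the twist-unit clause `hTU`
for EVERY globally minimal model of `W^{(D)}` from ONE of them (`Cd • W^{(D)} = Wd`, `#Ш(Wd)_an = qd`, `ord₃ qd ≤ 0`) by model-independence of `#Ш_an`
(`shaAn_eq_of_smul_eq_of_smul_eq_of_isGloballyMinimal`).  Curve-side inputs (`Addv ∧ SubGss` at `3`, `ρ̄₃` onto, `q₁` bad, `s₁, s₂` multiplicative, the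
très-ramifié clause off `S ∪ {q₁}`, SHAPE off `q₁`) and the displayed `hN hr Dt hc hLt` pass through.  CONDITIONAL on the six printed facts (GZK, modularity ×2,
JL, Pasten–Shimura component orders, PRIM₃); an instance maker, never progress on the leaf; BSD is NOT proved by this.
[cite: JetchevSkinnerWan2017, §7.4.2 (p. 31)] [cite: PastenShimura2024, Prop. 6.13, Lemma 6.15, Lemma 6.18 (pp. 23–24)] [cite: Zywina2015, Prop. 1.14]
[cite: Marcus2018, Ch. 3 Thm. 25] [cite: Miller2011LMS, Def. 1.1] -/
theorem leafRankOneUpper_three_at_saving_of_sqrtField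
    (hGZK : rank_eq_analyticRank_of_analyticRank_le_one) (hmod : hasEntireLFunction_rat)
    (hnf : exists_isNewformOf) (hJL : nonempty_shimuraParametrizationData)
    (hCO : PastenShimura2024_componentOrders) (hPrim : shimuraCurve_heegnerSystem_primitivesAtThree)
    (W : WeierstrassCurve ℚ) [W.IsElliptic] [W.IsGloballyMinimal]
    (hadd : Addv W 3) (hsub : SubGss W 3) (hr : W.analyticRank = 1) (hsurj : Surj W 3)
    {N : ℕ} [NeZero N] (hN : W.conductorNorm ℤ = N)
    (Dt : ModularParametrizationData W N) (hc : ¬ (3 : ℤ) ∣ Dt.c)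
    (q₁ : ℕ) [Fact q₁.Prime] (hbad₁ : ¬ W.HasGoodReductionAtPrime q₁)
    {s₁ s₂ : ℕ} [Fact s₁.Prime] [Fact s₂.Prime] (hne : s₁ ≠ s₂) (hs₁q : s₁ ≠ q₁) (hs₂q : s₂ ≠ q₁)
    (hm₁ : W.HasMultiplicativeReductionAtPrime s₁) (hm₂ : W.HasMultiplicativeReductionAtPrime s₂)
    (hFC : ∀ (ℓ : ℕ) [Fact ℓ.Prime], ℓ ≠ s₁ → ℓ ≠ s₂ → ℓ ≠ q₁ → W.HasSplitMultiplicativeReductionAtPrime ℓ →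
      ¬ 3 ∣ padicValInt ℓ W.minimalDiscriminantInt)
    (hshape : ∀ (q : ℕ) [Fact q.Prime], q ≠ q₁ → 3 ∣ (W.baseChange ℚ_[q]).localTamagawaNumber ℤ_[q] →
      W.HasSplitMultiplicativeReductionAtPrime q)
    (hDEG : ¬ 3 ∣ padicValInt s₁ W.minimalDiscriminantInt ∨ s₁ = 2 ∨ ¬ 3 ∣ s₁ - 1)
    (D : ℤ) [hD : Fact (D < 0)] (hD4 : D % 4 = 1) (hsfN : Squarefree D.natAbs)
    (hi₁ : (s₁ = 2 ∧ D % 8 = 5) ∨ (s₁ ≠ 2 ∧ jacobiSym D s₁ = -1)) (hnd₁ : ¬ (s₁ : ℤ) ∣ D)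
    (hi₂ : (s₂ = 2 ∧ D % 8 = 5) ∨ (s₂ ≠ 2 ∧ jacobiSym D s₂ = -1)) (hnd₂ : ¬ (s₂ : ℤ) ∣ D)
    (hjac : ∀ ℓ : ℕ, ℓ.Prime → ℓ ∣ W.conductorNorm ℤ → ℓ ≠ s₁ → ℓ ≠ s₂ → ℓ ≠ 2 → jacobiSym D ℓ = 1)
    (h2 : 2 ∣ W.conductorNorm ℤ → s₁ ≠ 2 → s₂ ≠ 2 → D % 8 = 1)
    (hLt : (W.quadraticTwist (D : ℚ)).entireLFunction 1 ≠ 0)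
    (Wd : WeierstrassCurve ℚ) [Wd.IsElliptic] [Wd.IsGloballyMinimal] (Cd : VariableChange ℚ)
    (hWd : Cd • W.quadraticTwist (D : ℚ) = Wd) {qd : ℚ} (hqd : shaAn Wd = (qd : ℂ)) (hvd : padicValRat 3 qd ≤ 0) :
    MissingUpperBoundAt W 3 := by
  have hsf : Squarefree D := Int.squarefree_natAbs.mp hsfN
  obtain ⟨hK, hdisc⟩ := isImaginaryQuadratic_and_discr_sqrtField D hD4 hsf
  have h2K := sqrtField.finrank_eq_two D
  have hodd : Odd (NumberField.discr (sqrtField D)) := by rw [hdisc, Int.odd_iff]; omega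
  have hin : ∀ (s : ℕ) [Fact s.Prime], (s = 2 ∧ D % 8 = 5) ∨ (s ≠ 2 ∧ jacobiSym D s = -1) → ¬ (s : ℤ) ∣ D →
      ((Ideal.span {(s : ℤ)}).primesOver (𝓞 (sqrtField D))).ncard = 1 ∧ ¬ (s : ℤ) ∣ NumberField.discr (sqrtField D) := by
    intro s _ hi hnd
    refine ⟨?_, by rw [hdisc]; exact hnd⟩
    rcases hi with ⟨h12, h5⟩ | ⟨-, hj⟩
    · subst h12
      have h := ncard_primesOver_two_eq_one_of_discr_mod_eight h2K (by rw [hdisc]; exact h5)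
      simpa using h
    · exact ncard_primesOver_eq_one_of_jacobiSym_eq_neg_one h2K (Fact.out : s.Prime) (by rw [hdisc]; exact hj)
  have hTU : ∀ (Wd' : WeierstrassCurve ℚ) [Wd'.IsElliptic] [Wd'.IsGloballyMinimal] (Cd' : VariableChange ℚ),
      Cd' • W.quadraticTwist (NumberField.discr (sqrtField D) : ℚ) = Wd' →
        ∃ qd : ℚ, shaAn Wd' = (qd : ℂ) ∧ padicValRat 3 qd ≤ 0 := by
    intro Wd' _ _ Cd' hWd'
    rw [hdisc] at hWd'
    exact ⟨qd, (shaAn_eq_of_smul_eq_of_smul_eq_of_isGloballyMinimal hWd hWd').trans hqd, hvd⟩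
  have hCM : ¬ W.HasCM := fun h ↦ W.not_hasSurjectiveModNGaloisRep_of_hasCM h Nat.prime_three (by norm_num) hsurj
  have hs₁S : ∀ {ℓ : ℕ}, ℓ ∉ ({s₁, s₂} : Finset ℕ) → ℓ ≠ s₁ := fun h h' ↦ h (by simp [h'])
  have hs₂S : ∀ {ℓ : ℕ}, ℓ ∉ ({s₁, s₂} : Finset ℕ) → ℓ ≠ s₂ := fun h h' ↦ h (by simp [h'])
  have hnotin : ∀ {ℓ : ℕ}, ℓ ≠ s₁ → ℓ ≠ s₂ → ℓ ∉ ({s₁, s₂} : Finset ℕ) := fun h h' hm ↦ by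
    rcases Finset.mem_insert.mp hm with rfl | hm
    · exact h rfl
    · exact h' (Finset.mem_singleton.mp hm)
  have hcard : ({s₁, s₂} : Finset ℕ).card = 2 := by
    rw [Finset.card_insert_of_notMem (by simpa using hne), Finset.card_singleton]
  refine LeafShimuraInert.leafRankOneUpper_three_of_shimuraInertDatum_at_saving_of_twistUnit hGZK hmod hnf hJL hCO hPrim W hCM hadd hsub hr hsurj hN Dt hc
    q₁ hbad₁ {s₁, s₂} (by rw [hcard]; decide) (hnotin (Ne.symm hs₁q) (Ne.symm hs₂q)) ?_
    (fun ℓ _ hℓ hq hs ↦ hFC ℓ (hs₁S hℓ) (hs₂S hℓ) hq hs) hshape ?_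
    (sqrtField D) hK hodd ?_ (fun ℓ hℓ hℓN hℓS ↦ ?_) (by rw [hdisc]; exact hLt) hTU
  · intro ℓ hℓ
    rcases Finset.mem_insert.mp hℓ with rfl | hℓ
    · exact ⟨inferInstance, hm₁⟩
    · rw [Finset.mem_singleton] at hℓ; subst hℓ
      exact ⟨inferInstance, hm₂⟩
  · rcases hDEG with h | h
    · exact Or.inl ⟨s₁, by simp, h⟩
    · refine Or.inr (Or.inr ⟨{s₁}, by simp, by rw [hcard, Finset.card_singleton], fun q hq ↦ ?_⟩)
      rw [Finset.mem_singleton] at hq; subst hq; exact h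
  · intro ℓ hℓ
    rcases Finset.mem_insert.mp hℓ with rfl | hℓ
    · exact hin _ hi₁ hnd₁
    · rw [Finset.mem_singleton] at hℓ; subst hℓ
      exact hin _ hi₂ hnd₂
  · by_cases hℓ2 : ℓ = 2
    · subst hℓ2
      have h := ncard_primesOver_two_sqrtField_eq_two D (h2 hℓN (Ne.symm (hs₁S hℓS)) (Ne.symm (hs₂S hℓS))) hsf
      simpa using h
    · exact ncard_primesOver_sqrtField_eq_two_of_jacobiSym D hD4 hsf hℓ hℓ2 (hjac ℓ hℓ hℓN (hs₁S hℓS) (hs₂S hℓS) hℓ2)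

/-- **DOOR (TU₀|saving, rank zero): U₀ at a leaf curve on a SAVING ROW from the rank-zero saving-row certificate shape at `K = ℚ(√D)`.**  rhp-p2 g11's
`LeafShimuraInert.leafRankZeroUpper_three_of_shimuraInertDatum_at_saving_of_twistUnitZero` (p674548) at `S = {s₁, s₂}`, field data from the
`D`-congruences, `¬CM` from `ρ̄₃` onto and (DEG) in the flat form exactly as in `leafRankOneUpper_three_at_saving_of_sqrtField`; the twist has a SIMPLE zero
(`L(W^{(D)},1) = 0 ≠ L′(W^{(D)},1)`, displayed) and `ord₃ #Ш_an ≤ 0` on ONE hence every globally minimal model.  CONDITIONAL on the six printed facts; an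
instance maker, never progress on the leaf; BSD is NOT proved by this. [cite: JetchevSkinnerWan2017, §7.4.1–7.4.2 (pp. 30–31)]
[cite: PastenShimura2024, Prop. 6.13, Lemma 6.15, Lemma 6.18 (pp. 23–24)] [cite: GrossZagier1986, V.§2] [cite: Zywina2015, Prop. 1.14] [cite: Miller2011LMS, Def. 1.1] -/
theorem leafRankZeroUpper_three_at_saving_of_sqrtField
    (hGZK : rank_eq_analyticRank_of_analyticRank_le_one) (hmod : hasEntireLFunction_rat)
    (hnf : exists_isNewformOf) (hJL : nonempty_shimuraParametrizationData)
    (hCO : PastenShimura2024_componentOrders) (hPrim : shimuraCurve_heegnerSystem_primitivesAtThree)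
    (W : WeierstrassCurve ℚ) [W.IsElliptic] [W.IsGloballyMinimal]
    (hadd : Addv W 3) (hsub : SubGss W 3) (hr : W.analyticRank = 0) (hsurj : Surj W 3)
    {N : ℕ} [NeZero N] (hN : W.conductorNorm ℤ = N)
    (Dt : ModularParametrizationData W N) (hc : ¬ (3 : ℤ) ∣ Dt.c)
    (q₁ : ℕ) [Fact q₁.Prime] (hbad₁ : ¬ W.HasGoodReductionAtPrime q₁)
    {s₁ s₂ : ℕ} [Fact s₁.Prime] [Fact s₂.Prime] (hne : s₁ ≠ s₂) (hs₁q : s₁ ≠ q₁) (hs₂q : s₂ ≠ q₁)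
    (hm₁ : W.HasMultiplicativeReductionAtPrime s₁) (hm₂ : W.HasMultiplicativeReductionAtPrime s₂)
    (hFC : ∀ (ℓ : ℕ) [Fact ℓ.Prime], ℓ ≠ s₁ → ℓ ≠ s₂ → ℓ ≠ q₁ → W.HasSplitMultiplicativeReductionAtPrime ℓ →
      ¬ 3 ∣ padicValInt ℓ W.minimalDiscriminantInt)
    (hshape : ∀ (q : ℕ) [Fact q.Prime], q ≠ q₁ → 3 ∣ (W.baseChange ℚ_[q]).localTamagawaNumber ℤ_[q] →
      W.HasSplitMultiplicativeReductionAtPrime q)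
    (hDEG : ¬ 3 ∣ padicValInt s₁ W.minimalDiscriminantInt ∨ s₁ = 2 ∨ ¬ 3 ∣ s₁ - 1)
    (D : ℤ) [hD : Fact (D < 0)] (hD4 : D % 4 = 1) (hsfN : Squarefree D.natAbs)
    (hi₁ : (s₁ = 2 ∧ D % 8 = 5) ∨ (s₁ ≠ 2 ∧ jacobiSym D s₁ = -1)) (hnd₁ : ¬ (s₁ : ℤ) ∣ D)
    (hi₂ : (s₂ = 2 ∧ D % 8 = 5) ∨ (s₂ ≠ 2 ∧ jacobiSym D s₂ = -1)) (hnd₂ : ¬ (s₂ : ℤ) ∣ D)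
    (hjac : ∀ ℓ : ℕ, ℓ.Prime → ℓ ∣ W.conductorNorm ℤ → ℓ ≠ s₁ → ℓ ≠ s₂ → ℓ ≠ 2 → jacobiSym D ℓ = 1)
    (h2 : 2 ∣ W.conductorNorm ℤ → s₁ ≠ 2 → s₂ ≠ 2 → D % 8 = 1)
    (hLt0 : (W.quadraticTwist (D : ℚ)).entireLFunction 1 = 0)
    (hLt1 : deriv (W.quadraticTwist (D : ℚ)).entireLFunction 1 ≠ 0)
    (Wd : WeierstrassCurve ℚ) [Wd.IsElliptic] [Wd.IsGloballyMinimal] (Cd : VariableChange ℚ)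
    (hWd : Cd • W.quadraticTwist (D : ℚ) = Wd) {qd : ℚ} (hqd : shaAn Wd = (qd : ℂ)) (hvd : padicValRat 3 qd ≤ 0) :
    MissingUpperBoundAt W 3 := by
  have hsf : Squarefree D := Int.squarefree_natAbs.mp hsfN
  obtain ⟨hK, hdisc⟩ := isImaginaryQuadratic_and_discr_sqrtField D hD4 hsf
  have h2K := sqrtField.finrank_eq_two D
  have hodd : Odd (NumberField.discr (sqrtField D)) := by rw [hdisc, Int.odd_iff]; omega
  have hin : ∀ (s : ℕ) [Fact s.Prime], (s = 2 ∧ D % 8 = 5) ∨ (s ≠ 2 ∧ jacobiSym D s = -1) → ¬ (s : ℤ) ∣ D →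
      ((Ideal.span {(s : ℤ)}).primesOver (𝓞 (sqrtField D))).ncard = 1 ∧ ¬ (s : ℤ) ∣ NumberField.discr (sqrtField D) := by
    intro s _ hi hnd
    refine ⟨?_, by rw [hdisc]; exact hnd⟩
    rcases hi with ⟨h12, h5⟩ | ⟨-, hj⟩
    · subst h12
      have h := ncard_primesOver_two_eq_one_of_discr_mod_eight h2K (by rw [hdisc]; exact h5)
      simpa using h
    · exact ncard_primesOver_eq_one_of_jacobiSym_eq_neg_one h2K (Fact.out : s.Prime) (by rw [hdisc]; exact hj)
  have hTU : ∀ (Wd' : WeierstrassCurve ℚ) [Wd'.IsElliptic] [Wd'.IsGloballyMinimal] (Cd' : VariableChange ℚ),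
      Cd' • W.quadraticTwist (NumberField.discr (sqrtField D) : ℚ) = Wd' →
        ∃ qd : ℚ, shaAn Wd' = (qd : ℂ) ∧ padicValRat 3 qd ≤ 0 := by
    intro Wd' _ _ Cd' hWd'
    rw [hdisc] at hWd'
    exact ⟨qd, (shaAn_eq_of_smul_eq_of_smul_eq_of_isGloballyMinimal hWd hWd').trans hqd, hvd⟩
  have hCM : ¬ W.HasCM := fun h ↦ W.not_hasSurjectiveModNGaloisRep_of_hasCM h Nat.prime_three (by norm_num) hsurj
  have hs₁S : ∀ {ℓ : ℕ}, ℓ ∉ ({s₁, s₂} : Finset ℕ) → ℓ ≠ s₁ := fun h h' ↦ h (by simp [h'])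
  have hs₂S : ∀ {ℓ : ℕ}, ℓ ∉ ({s₁, s₂} : Finset ℕ) → ℓ ≠ s₂ := fun h h' ↦ h (by simp [h'])
  have hnotin : ∀ {ℓ : ℕ}, ℓ ≠ s₁ → ℓ ≠ s₂ → ℓ ∉ ({s₁, s₂} : Finset ℕ) := fun h h' hm ↦ by
    rcases Finset.mem_insert.mp hm with rfl | hm
    · exact h rfl
    · exact h' (Finset.mem_singleton.mp hm)
  have hcard : ({s₁, s₂} : Finset ℕ).card = 2 := by
    rw [Finset.card_insert_of_notMem (by simpa using hne), Finset.card_singleton]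
  refine LeafShimuraInert.leafRankZeroUpper_three_of_shimuraInertDatum_at_saving_of_twistUnitZero hGZK hmod hnf hJL hCO hPrim W hCM hadd hsub hr hsurj hN Dt hc
    q₁ hbad₁ {s₁, s₂} (by rw [hcard]; decide) (hnotin (Ne.symm hs₁q) (Ne.symm hs₂q)) ?_
    (fun ℓ _ hℓ hq hs ↦ hFC ℓ (hs₁S hℓ) (hs₂S hℓ) hq hs) hshape ?_
    (sqrtField D) hK hodd ?_ (fun ℓ hℓ hℓN hℓS ↦ ?_) (by rw [hdisc]; exact hLt0) (by rw [hdisc]; exact hLt1) hTU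
  · intro ℓ hℓ
    rcases Finset.mem_insert.mp hℓ with rfl | hℓ
    · exact ⟨inferInstance, hm₁⟩
    · rw [Finset.mem_singleton] at hℓ; subst hℓ
      exact ⟨inferInstance, hm₂⟩
  · rcases hDEG with h | h
    · exact Or.inl ⟨s₁, by simp, h⟩
    · refine Or.inr (Or.inr ⟨{s₁}, by simp, by rw [hcard, Finset.card_singleton], fun q hq ↦ ?_⟩)
      rw [Finset.mem_singleton] at hq; subst hq; exact h
  · intro ℓ hℓ
    rcases Finset.mem_insert.mp hℓ with rfl | hℓ
    · exact hin _ hi₁ hnd₁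
    · rw [Finset.mem_singleton] at hℓ; subst hℓ
      exact hin _ hi₂ hnd₂
  · by_cases hℓ2 : ℓ = 2
    · subst hℓ2
      have h := ncard_primesOver_two_sqrtField_eq_two D (h2 hℓN (Ne.symm (hs₁S hℓS)) (Ne.symm (hs₂S hℓS))) hsf
      simpa using h
    · exact ncard_primesOver_sqrtField_eq_two_of_jacobiSym D hD4 hsf hℓ hℓ2 (hjac ℓ hℓ hℓN (hs₁S hℓS) (hs₂S hℓS) hℓ2)

end Summit.BirchSwinnertonDyer.BirchSwinnertonDyer.Theorems.RamifiedHeegnerPairTwistUnitSaving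

end
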